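import Summits.NavierStokesRegularity.FluidComputer.PalasekTowerRingPusherSign
import Summits.NavierStokesRegularity.FluidComputer.PalasekTowerTameCarrierAtRun
import Summits.NavierStokesRegularity.FluidComputer.PalasekTowerGermHostFarFieldSign
import Summits.NavierStokesRegularity.NavierStokesRegularity.Theorems.EpisodeBaseT.Negative.TinyBlobSterileCarrierSwirlIff
import Literature.Analysis.FluidPDE.EulerTimeScaling

/-!
# The STERILE TAME CARRIER AT ARBITRARY RATES `R`: the strict slot `LevelZeroDataAt R · 7` is filled by an AXISYMMETRIC
# SWIRL-FREE profile `tinyProfileAt R a + μ • ringPusher δ*` of arbitrarily small `L³` size, with a free run under the cap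

Cell `ns-blowup`, seat `ns-blowup-fc-prover-2` (g11; D-0074 GROUP C «BRIDGE SUPPORT»). Route `PalasekTowerBreakdown` (rev 19):
crux stmt-NavierStokesRegularity-20303 `EpisodeBaseT`, heredity pair 20304 / 20305; stub D2 `SterileMechanismDoorT` of the
strategist's line `Cruxes/EpisodeBaseT/Lines/doormirror.lean`. The sterile twin of ecbridge-3's `PalasekTowerTameCarrierAt` /
`PalasekTowerTameCarrierAtRun` (layer L3 of the door port): SAME flat even blob `tinyProfileAt R a`, the swirling `faintPusher`
REPLACED by the coaxial poloidal `ringPusher` (`PalasekTowerRingPusher*`). LABEL: E–C typing (KERNEL construction: two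
definitions with body — the thinness `ringThin` chosen by `exists_ringPusher_anchor_integral_pos`, and the carrier — plus
theorems). WHAT THIS IS NOT: not Navier–Stokes evidence — ONE explicit family of compactly supported divergence-free sterile
profiles passing the LEVEL-`0` readouts and the STRICT ANCHOR TEST at the rates `R`, and a Kato small-data free run of one of
them; nothing about any crux, `RungG 1` or blow-up.

* §1 `ringThin` and its three properties; `sterileCarrierAt R a μ = tinyProfileAt R a + μ • ringPusher ringThin`; near the
  origin (`‖x‖ < 9/2`) the carrier is the blob, far (`‖x‖ > 1`, `a ≤ 1/2`) it is the pusher;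
* §2 **`levelZeroDataAt_sterileCarrierAt`**: `LevelZeroDataAt R (sterileCarrierAt R a μ) 7` for `0 < a ≤ min (5/256) (5/N₀(R))
  ⊓ strainConst/N₀(R)` and `0 < μ` with `μ (M + 1) ≤ Y₀(R)/2` (`M` a speed bound of the pusher): readouts from the blob
  (ecbridge-3/4, by name), speed argmax only at `0`, and the STRICT ANCHOR TEST by `anchor_test_iff_fderiv3` (flat even blob
  ⇒ the test is the positivity of `∫ D³Γ(0 − x)(μP, μP, Y₀e₃)`, which is `exists_ringPusher_anchor_integral_pos`);
* §3 **sterility**: `IsAxisymmetric (sterileCarrierAt R a μ) ∧ HasNoSwirl (sterileCarrierAt R a μ)` (the blob is sterile —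
  refuters' `isAxisymmetric_tinyProfileAt` / `hasNoSwirl_tinyProfileAt`, by name — and so is the ring pusher);
* §4 `L³`-smallness and **`exists_sterile_levelZeroDataAt_tame_freeRun_cap`**: under the registered band `2Y₀ ≤ Y₁`, for every
  margin `η ≤ Y₁(R)/3` a STERILE strict-slot carrier at `R` with a classical finite-energy free run on `[1, τ₁(R)]` below
  `(5/3) Y₁(R) − η` (Kato small `L³` data + Leray, `exists_classical_run_norm_le_two_mul_Icc`, verbatim as in the record).

References: S. Palasek, arXiv:2605.13827 §3.3 [cite: Palasek2026ElementaryModel, §3.3]; A. J. Majda, A. L. Bertozzi (CUP 2002)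
§1.8 Prop. 1.16 [cite: MajdaBertozziCUP2002, §1.8 Prop. 1.16]; T. Kato, Math. Z. 187 (1984), Thm. 2–4 [cite: Kato1984, Thm. 2–4].
-/

noncomputable section

namespace Summit.NavierStokesRegularity.FluidComputer.PalasekTowerClayBridge.Germ

open Set Function Filter Topology InnerProductSpace Metric MeasureTheory Real
open scoped Topology ContDiff RealInnerProductSpace ENNReal Laplacian

open Literature.Analysis.FluidPDE TinyBlob
open Summit.NavierStokesRegularity.EpisodeBaseTTameCarrierOfRecordHasSwirl

-- nested operator types `ℝ³ →L[ℝ] ℝ³ →L[ℝ] ℝ` (third derivatives of the Newtonian kernel)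
set_option maxSynthPendingDepth 3

variable {R : TowerRates} {a mu : ℝ}

/-! ## §1 The thinness, the carrier, near/far -/

/-- **The thinness `δ*` of the ring pusher**, chosen once and for all by `exists_ringPusher_anchor_integral_pos`. [folklore] -/
def ringThin : ℝ := Classical.choose exists_ringPusher_anchor_integral_pos

/-- `0 < δ* ≤ 1/4` and the sign of the anchor integral at `δ*`. [folklore] -/
theorem ringThin_spec : 0 < ringThin ∧ ringThin ≤ 1 / 4 ∧ ∀ μ c : ℝ, μ ≠ 0 → 0 < c →
    0 < ∫ x, fderiv ℝ (fun w => fderiv ℝ (fun w' => fderiv ℝ newtonKernel w' ((μ • ringPusher ringThin) x)) w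
      ((μ • ringPusher ringThin) x)) ((0 : EuclideanSpace ℝ (Fin 3)) - x) (c • e₃) :=
  Classical.choose_spec exists_ringPusher_anchor_integral_pos

/-- **A speed bound `M ≥ 0` of the ring pusher at `δ*`.** [folklore] -/
def ringSpeed : ℝ := Classical.choose (exists_norm_ringPusher_le ringThin_spec.1 ringThin_spec.2.1)

/-- `0 ≤ M` and `‖ringPusher δ* x‖ ≤ M`. [folklore] -/
theorem ringSpeed_spec : 0 ≤ ringSpeed ∧ ∀ x, ‖ringPusher ringThin x‖ ≤ ringSpeed :=
  Classical.choose_spec (exists_norm_ringPusher_le ringThin_spec.1 ringThin_spec.2.1)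

/-- **THE STERILE CARRIER AT THE RATES `R`**: `tinyProfileAt R a + μ • ringPusher δ*`. [folklore] -/
def sterileCarrierAt (R : TowerRates) (a μ : ℝ) : EuclideanSpace ℝ (Fin 3) → EuclideanSpace ℝ (Fin 3) :=
  tinyProfileAt R a + μ • ringPusher ringThin

/-- Pointwise form. [folklore] -/
theorem sterileCarrierAt_apply (R : TowerRates) (a μ : ℝ) (x : EuclideanSpace ℝ (Fin 3)) :
    sterileCarrierAt R a μ x = tinyProfileAt R a x + μ • ringPusher ringThin x := rfl

/-- Near the origin (`‖x‖ < 9/2`) the carrier is the blob; far (`‖x‖ > 1`, `a ≤ 1/2`) it is the scaled pusher. [folklore] -/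
theorem sterileCarrierAt_near_far (ha : 0 < a) (ha2 : a ≤ 1 / 2) :
    (∀ x : EuclideanSpace ℝ (Fin 3), ‖x‖ < 9 / 2 → sterileCarrierAt R a mu x = tinyProfileAt R a x) ∧
      ∀ x : EuclideanSpace ℝ (Fin 3), 1 < ‖x‖ → sterileCarrierAt R a mu x = mu • ringPusher ringThin x := by
  refine ⟨fun x hx => ?_, fun x hx => ?_⟩
  · rw [sterileCarrierAt_apply, ringPusher_eq_zero_of_norm_lt ringThin_spec.1 ringThin_spec.2.1 hx, smul_zero, add_zero]
  · rw [sterileCarrierAt_apply, tinyProfileAt_eq_zero_of_norm_gt ha (by linarith), zero_add]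

/-- **Speed ceiling and argmax**: `‖U x‖ ≤ Y₀(R)` with equality only at `x = 0`, provided `0 ≤ μ`, `μ (M + 1) ≤ Y₀(R)/2`,
`a ≤ 1/2`. [folklore] -/
theorem norm_sterileCarrierAt_le (ha : 0 < a) (ha2 : a ≤ 1 / 2) (hmu : 0 ≤ mu) (hmuY : mu * (ringSpeed + 1) ≤ R.Y 0 / 2) :
    (∀ x, ‖sterileCarrierAt R a mu x‖ ≤ R.Y 0) ∧ ∀ x, ‖sterileCarrierAt R a mu x‖ = R.Y 0 → x = 0 := by
  obtain ⟨hnear, hfar⟩ := sterileCarrierAt_near_far (R := R) (mu := mu) ha ha2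
  obtain ⟨hM0, hM⟩ := ringSpeed_spec
  have hY := R.Y_pos 0
  have hpush : ∀ x, ‖mu • ringPusher ringThin x‖ < R.Y 0 := fun x => by
    rw [norm_smul, Real.norm_eq_abs, abs_of_nonneg hmu]
    have h1 : mu * ‖ringPusher ringThin x‖ ≤ mu * ringSpeed := mul_le_mul_of_nonneg_left (hM x) hmu
    nlinarith
  refine ⟨fun x => ?_, fun x hx => ?_⟩
  · by_cases h : ‖x‖ < 9 / 2
    · rw [hnear x h]; exact norm_tinyProfileAt_le ha.ne' x
    · push Not at h
      rw [hfar x (by linarith)]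
      exact (hpush x).le
  · by_cases h : ‖x‖ < 9 / 2
    · rw [hnear x h] at hx; exact eq_zero_of_norm_tinyProfileAt_eq ha.ne' hx
    · push Not at h
      rw [hfar x (by linarith)] at hx
      exact absurd hx (hpush x).ne

/-! ## §2 The strict slot -/

/-- The scaled pusher: smooth, compactly supported, divergence free, supported in the shell `9/2 ≤ ‖x‖ ≤ 28/5`. [folklore] -/
theorem smul_ringPusher_static (μ : ℝ) :
    ContDiff ℝ ∞ (μ • ringPusher ringThin) ∧ HasCompactSupport (μ • ringPusher ringThin) ∧
      VectorCalculus.IsDivFree (μ • ringPusher ringThin) ∧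
      ∀ x ∈ tsupport (μ • ringPusher ringThin), 9 / 2 ≤ ‖x‖ ∧ ‖x‖ ≤ 28 / 5 := by
  obtain ⟨hδ, hδ4, -⟩ := ringThin_spec
  refine ⟨contDiff_const.smul (contDiff_ringPusher _), (hasCompactSupport_ringPusher hδ hδ4).smul_left, fun x => ?_,
    fun x hx => norm_bounds_of_mem_tsupport_ringPusher hδ hδ4 (tsupport_smul_subset_right (fun _ => μ) _ hx)⟩
  show VectorCalculus.divergence (fun y => μ • ringPusher ringThin y) x = 0
  rw [divergence_const_smul_apply (((contDiff_ringPusher _).differentiable (by simp)) x), isDivFree_ringPusher _ x, mul_zero]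

/-- **THE STRICT ANCHOR TEST AT EVERY VISCOSITY** for `0 < μ`, `μ (M + 1) ≤ Y₀(R)/2`, `a ≤ 1/2`: at the (unique) speed
argmax `0` the blob is even and flat, so by `anchor_test_iff_fderiv3` the test is `0 < ∫ D³Γ(0 − x)(μP x, μP x, Y₀(R) e₃) dx`,
which is the sign theorem of the ring pusher. [cite: MajdaBertozziCUP2002, §1.8 Prop. 1.16] -/
theorem anchor_sterileCarrierAt (ha : 0 < a) (ha2 : a ≤ 1 / 2) (hmu : 0 < mu) (hmuY : mu * (ringSpeed + 1) ≤ R.Y 0 / 2)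
    (ν : ℝ) (x : EuclideanSpace ℝ (Fin 3)) (hx : ‖sterileCarrierAt R a mu x‖ = R.Y 0) :
    0 < ⟪sterileCarrierAt R a mu x, accel ν (sterileCarrierAt R a mu) x⟫ := by
  obtain rfl := (norm_sterileCarrierAt_le ha ha2 hmu.le hmuY).2 x hx
  obtain ⟨heven, -, hflat⟩ := tinyProfileAt_even_flat R a
  obtain ⟨h₂, h₂c, hdiv₂, hshell⟩ := smul_ringPusher_static mu
  have h0 : tinyProfileAt R a 0 = R.Y 0 • e₃ := (tinyProfileAt_zero R a).1
  have hfar : ∀ y ∈ tsupport (mu • ringPusher ringThin), (4 : ℝ) < ‖(0 : EuclideanSpace ℝ (Fin 3)) - y‖ :=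
    fun y hy => by rw [zero_sub, norm_neg]; linarith [(hshell y hy).1]
  have hdisj : Disjoint (tsupport (tinyProfileAt R a)) (tsupport (mu • ringPusher ringThin)) := by
    refine Set.disjoint_left.2 fun y hy hy' => ?_
    have h1 : ‖y‖ ≤ 2 * a := by
      have := tsupport_tinyProfileAt_subset ha hy
      rwa [mem_closedBall, dist_zero_right] at this
    linarith [(hshell y hy').1]
  rw [sterileCarrierAt, anchor_test_iff_fderiv3 (contDiff_tinyProfileAt R a) (hasCompactSupport_tinyProfileAt ha)
    (isDivFree_tinyProfileAt ha.ne') heven h₂ h₂c hdiv₂ hdisj (by norm_num : (0 : ℝ) < 4) hfar, hflat, inner_zero_right,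
    mul_zero, neg_zero, h0]
  exact ringThin_spec.2.2 mu (R.Y 0) hmu.ne' (R.Y_pos 0)

/-- `U` is smooth, divergence free, `tsupport U ⊆ B̄(0, 7)` (`a ≤ 1/2`). [folklore] -/
theorem sterileCarrierAt_static (ha : 0 < a) (ha2 : a ≤ 1 / 2) (μ : ℝ) :
    ContDiff ℝ ∞ (sterileCarrierAt R a μ) ∧ VectorCalculus.IsDivFree (sterileCarrierAt R a μ) ∧
      tsupport (sterileCarrierAt R a μ) ⊆ closedBall (0 : EuclideanSpace ℝ (Fin 3)) 7 := by
  obtain ⟨h₂, h₂c, hdiv₂, hshell⟩ := smul_ringPusher_static μ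
  refine ⟨(contDiff_tinyProfileAt R a).add h₂, fun x => ?_, ?_⟩
  · have h1 := isDivFree_tinyProfileAt (R := R) ha.ne' x
    have h2 := hdiv₂ x
    rw [sterileCarrierAt]
    show VectorCalculus.divergence (fun y => tinyProfileAt R a y + (μ • ringPusher ringThin) y) x = 0
    rw [divergence_add_apply ((contDiff_tinyProfileAt R a).differentiable (by simp) x) (h₂.differentiable (by simp) x), h1, h2,
      add_zero]
  · rw [sterileCarrierAt]
    refine (tsupport_add _ _).trans (union_subset ((tsupport_tinyProfileAt_subset ha).trans
      (closedBall_subset_closedBall (by linarith))) fun x hx => ?_)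
    rw [mem_closedBall, dist_zero_right]
    linarith [(hshell x hx).2]

/-- **THE STERILE CARRIER FILLS THE STRICT SLOT AT THE RATES `R`**: `LevelZeroDataAt R (sterileCarrierAt R a μ) 7` for
`0 < a ≤ 5/256`, `a ≤ 5/N₀(R)`, `a ≤ strainConst/N₀(R)`, `0 < μ`, `μ (M + 1) ≤ Y₀(R)/2`. [cite: Palasek2026ElementaryModel, §3.3] -/
theorem levelZeroDataAt_sterileCarrierAt (ha : 0 < a) (h5 : a ≤ 5 / 256) (h5N : a ≤ 5 / R.N 0)
    (hκ : a ≤ strainConst / R.N 0) (hmu : 0 < mu) (hmuY : mu * (ringSpeed + 1) ≤ R.Y 0 / 2) :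
    LevelZeroDataAt R (sterileCarrierAt R a mu) 7 := by
  have ha2 : a ≤ 1 / 2 := h5.trans (by norm_num)
  obtain ⟨hsm, hdiv, hsupp⟩ := sterileCarrierAt_static (R := R) ha ha2 mu
  obtain ⟨hnear, -⟩ := sterileCarrierAt_near_far (R := R) (mu := mu) ha ha2
  have hopen : IsOpen {y : EuclideanSpace ℝ (Fin 3) | ‖y‖ < 9 / 2} := isOpen_lt continuous_norm continuous_const
  have hfd : ∀ x : EuclideanSpace ℝ (Fin 3), ‖x‖ < 9 / 2 →
      fderiv ℝ (sterileCarrierAt R a mu) x = fderiv ℝ (tinyProfileAt R a) x := fun x hx => by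
    have hev : sterileCarrierAt R a mu =ᶠ[𝓝 x] tinyProfileAt R a := by
      filter_upwards [hopen.mem_nhds hx] with y hy
      exact hnear y hy
    exact hev.fderiv_eq
  refine { smooth := hsm, support := hsupp, divFree := hdiv, ceiling := (norm_sterileCarrierAt_le ha ha2 hmu.le hmuY).1,
           floor := ⟨0, by simp, ?_⟩, strain := ?_, core := ?_,
           anchor := anchor_sterileCarrierAt ha ha2 hmu hmuY 1 }
  · rw [hnear 0 (by simp), (tinyProfileAt_zero R a).2]
  · have hn : ‖a • strainPt‖ ≤ 2 * a := by
      rw [norm_smul, Real.norm_eq_abs, abs_of_pos ha]; nlinarith [norm_strainPt_le]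
    refine ⟨a • strainPt, by linarith, ?_⟩
    rw [hfd _ (by linarith)]
    exact strain_tinyProfileAt ha hκ
  · obtain ⟨x, γ, hx, hγ, h01, hball, hvel, hcirc⟩ := core_tinyProfileAt (R := R) ha h5N
    refine ⟨x, γ, by linarith, hγ, h01, hball, hvel, ?_⟩
    have hc : circulation (sterileCarrierAt R a mu) γ = circulation (tinyProfileAt R a) γ := by
      unfold circulation
      refine intervalIntegral.integral_congr fun s hs => ?_
      rw [uIcc_of_le zero_le_one] at hs
      have hs' : ‖γ s‖ < 9 / 2 := by
        have hb := hball s hs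
        rw [mem_closedBall, dist_eq_norm] at hb
        have h1N : 1 / R.N 0 ≤ 1 := by
          rw [div_le_one (R.N_pos 0)]; exact (R.one_lt_N 0).le
        have : ‖γ s‖ ≤ ‖γ s - x‖ + ‖x‖ := norm_le_norm_sub_add (γ s) x
        linarith
      simp only [hnear _ hs']
    rw [hc]
    exact hcirc

/-! ## §3 Sterility -/

/-- **THE STERILE CARRIER IS AXISYMMETRIC AND SWIRL FREE** (blob: `isAxisymmetric_tinyProfileAt`, `hasNoSwirl_tinyProfileAt`;
ring pusher: `isAxisymmetric_ringPusher`, `hasNoSwirl_ringPusher`). [folklore] -/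
theorem sterileCarrierAt_sterile (R : TowerRates) (a μ : ℝ) :
    IsAxisymmetric (sterileCarrierAt R a μ) ∧ HasNoSwirl (sterileCarrierAt R a μ) := by
  have hA1 := isAxisymmetric_tinyProfileAt R a
  have hA2 : IsAxisymmetric (fun y => μ • ringPusher ringThin y) := (isAxisymmetric_ringPusher ringThin).const_smul μ
  have hS1 := hasNoSwirl_tinyProfileAt R a
  have hS2 : HasNoSwirl (fun y => μ • ringPusher ringThin y) := (hasNoSwirl_ringPusher ringThin).const_smul μ
  refine ⟨fun θ x => ?_, fun x => ?_⟩
  · have h2 : μ • ringPusher ringThin (rotZ θ x) = rotZ θ (μ • ringPusher ringThin x) := hA2 θ x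
    rw [sterileCarrierAt_apply, sterileCarrierAt_apply, hA1 θ x, h2, ← rotZL_apply, ← rotZL_apply, ← rotZL_apply, map_add]
  · have h := swirl_add (tinyProfileAt R a) (μ • ringPusher ringThin) x
    rw [show tinyProfileAt R a + μ • ringPusher ringThin = sterileCarrierAt R a μ from rfl] at h
    rw [h, hS1 x, zero_add]
    exact hS2 x

/-! ## §4 `L³` smallness and the sterile tame run -/

/-- `‖U‖₃ ≤ ‖tinyProfileAt R a‖₃ + |μ| ‖ringPusher δ*‖₃`. [folklore] -/
theorem eLpNorm_sterileCarrierAt_le (R : TowerRates) (a μ : ℝ) :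
    eLpNorm (sterileCarrierAt R a μ) 3 volume ≤
      eLpNorm (tinyProfileAt R a) 3 volume + ‖μ‖ₑ * eLpNorm (ringPusher ringThin) 3 volume := by
  rw [sterileCarrierAt, ← eLpNorm_const_smul μ (ringPusher ringThin) 3 volume]
  exact eLpNorm_add_le (contDiff_tinyProfileAt R a).continuous.aestronglyMeasurable
    ((continuous_ringPusher _).const_smul μ).aestronglyMeasurable (by norm_num)

/-- The ring pusher is in `L³`. [folklore] -/
theorem eLpNorm_ringPusher_lt_top : eLpNorm (ringPusher ringThin) 3 volume < ⊤ :=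
  ((continuous_ringPusher _).memLp_of_hasCompactSupport
    (hasCompactSupport_ringPusher ringThin_spec.1 ringThin_spec.2.1)).eLpNorm_lt_top

/-- **STERILE CARRIERS OF ARBITRARILY SMALL `L³` SIZE FILL THE STRICT SLOT AT `R`**: for every `δ > 0` there are admissible
`a`, `μ` with `LevelZeroDataAt R (sterileCarrierAt R a μ) 7` and `‖sterileCarrierAt R a μ‖_{L³} ≤ δ`.
[cite: Palasek2026ElementaryModel, §3.3] [cite: Kato1984, Thm. 2] -/
theorem exists_sterile_levelZeroDataAt_eLpNorm_le (R : TowerRates) {δ : ℝ} (hδ : 0 < δ) :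
    ∃ a μ : ℝ, 0 < a ∧ 0 < μ ∧
      LevelZeroDataAt R (sterileCarrierAt R a μ) 7 ∧
      eLpNorm (sterileCarrierAt R a μ) 3 volume ≤ ENNReal.ofReal δ := by
  have hYw := Host.wide_Y_zero_pos
  have hYR := R.Y_pos 0
  have hN := R.N_pos 0
  have hv := unitBallVol_nonneg
  have hκ := strainConst_pos
  -- the blob scale (verbatim from the record)
  set D : ℝ := 8 * (unitBallVol + 1) * TowerRates.wide.Y 0 ^ 3 with hD
  have hDpos : 0 < D := by positivity
  set δ' : ℝ := δ / 2 * TowerRates.wide.Y 0 / R.Y 0 with hδ'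
  have hδ'pos : 0 < δ' := by positivity
  set a : ℝ := min (min (5 / 256) (5 / R.N 0)) (min (strainConst / R.N 0) (δ' ^ 3 / D)) with ha
  have ha0 : 0 < a := lt_min (lt_min (by norm_num) (by positivity)) (lt_min (by positivity) (by positivity))
  have h5 : a ≤ 5 / 256 := (min_le_left _ _).trans (min_le_left _ _)
  have h5N : a ≤ 5 / R.N 0 := (min_le_left _ _).trans (min_le_right _ _)
  have hκN : a ≤ strainConst / R.N 0 := (min_le_right _ _).trans (min_le_left _ _)
  have haD : a ≤ δ' ^ 3 / D := (min_le_right _ _).trans (min_le_right _ _)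
  have ha1 : a ≤ 1 := h5.trans (by norm_num)
  have hsmall : 8 * a * (unitBallVol + 1) * TowerRates.wide.Y 0 ^ 3 ≤
      (δ / 2 * TowerRates.wide.Y 0 / R.Y 0) ^ 3 := by
    rw [le_div_iff₀ hDpos] at haD
    calc 8 * a * (unitBallVol + 1) * TowerRates.wide.Y 0 ^ 3 = a * D := by rw [hD]; ring
      _ ≤ δ' ^ 3 := haD
  have hblob := eLpNorm_tinyProfileAt_le_of_small (R := R) ha0 ha1 (half_pos hδ) hsmall
  -- the pusher amplitude
  set P : ℝ := (eLpNorm (ringPusher ringThin) 3 volume).toReal with hP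
  have hP0 : 0 ≤ P := ENNReal.toReal_nonneg
  have hPeq : eLpNorm (ringPusher ringThin) 3 volume = ENNReal.ofReal P := by
    rw [hP, ENNReal.ofReal_toReal eLpNorm_ringPusher_lt_top.ne]
  obtain ⟨hM0, -⟩ := ringSpeed_spec
  set μ : ℝ := min (R.Y 0 / 2 / (ringSpeed + 1)) ((δ / 2) / (P + 1)) with hμ
  have hμ0 : 0 < μ := lt_min (by positivity) (by positivity)
  have hμY : μ * (ringSpeed + 1) ≤ R.Y 0 / 2 := by
    have h1 : μ ≤ R.Y 0 / 2 / (ringSpeed + 1) := min_le_left _ _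
    rwa [le_div_iff₀ (by positivity)] at h1
  have hpush : ‖μ‖ₑ * eLpNorm (ringPusher ringThin) 3 volume ≤ ENNReal.ofReal (δ / 2) := by
    rw [hPeq, Real.enorm_eq_ofReal_abs, abs_of_pos hμ0, ← ENNReal.ofReal_mul hμ0.le]
    refine ENNReal.ofReal_le_ofReal ?_
    have h1 : μ ≤ (δ / 2) / (P + 1) := min_le_right _ _
    rw [le_div_iff₀ (by positivity)] at h1
    nlinarith
  refine ⟨a, μ, ha0, hμ0, levelZeroDataAt_sterileCarrierAt ha0 h5 h5N hκN hμ0 hμY, ?_⟩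
  calc eLpNorm (sterileCarrierAt R a μ) 3 volume
      ≤ eLpNorm (tinyProfileAt R a) 3 volume + ‖μ‖ₑ * eLpNorm (ringPusher ringThin) 3 volume :=
        eLpNorm_sterileCarrierAt_le R a μ
    _ ≤ ENNReal.ofReal (δ / 2) + ENNReal.ofReal (δ / 2) := add_le_add hblob hpush
    _ = ENNReal.ofReal δ := by rw [← ENNReal.ofReal_add (by positivity) (by positivity)]; ring_nf

/-- The same with the hypotheses a free-run theorem consumes spelled out, AND sterility. [cite: Palasek2026ElementaryModel, §3.3] -/
theorem exists_sterile_levelZeroDataAt_small (R : TowerRates) (δ : ℝ) (hδ : 0 < δ) :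
    ∃ U : EuclideanSpace ℝ (Fin 3) → EuclideanSpace ℝ (Fin 3),
      LevelZeroDataAt R U 7 ∧ IsAxisymmetric U ∧ HasNoSwirl U ∧ ContDiff ℝ ∞ U ∧ HasCompactSupport U ∧
      VectorCalculus.IsDivFree U ∧ (∀ x, ‖U x‖ ≤ R.Y 0) ∧ (eLpNorm U 3 volume).toReal ≤ δ := by
  obtain ⟨a, μ, -, -, hLZ, hL3⟩ := exists_sterile_levelZeroDataAt_eLpNorm_le R hδ
  obtain ⟨hax, hsw⟩ := sterileCarrierAt_sterile R a μ
  refine ⟨sterileCarrierAt R a μ, hLZ, hax, hsw, hLZ.smooth, hLZ.confined.2, hLZ.divFree, hLZ.ceiling, ?_⟩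
  have hlt : eLpNorm (sterileCarrierAt R a μ) 3 volume < ⊤ := hL3.trans_lt ENNReal.ofReal_lt_top
  have := (ENNReal.toReal_le_toReal hlt.ne ENNReal.ofReal_ne_top).2 hL3
  rwa [ENNReal.toReal_ofReal hδ.le] at this

/-- **THE STERILE TAME CARRIER RUN AT THE RATES `R`.** There is a STERILE strict-slot carrier `U` at `R`
(`LevelZeroDataAt R U 7`, axisymmetric, swirl free) with a classical finite-energy FREE Navier–Stokes run `(v, q)` at unit
viscosity on `[1, τ₁(R)]` from `v 1 = U` obeying `‖v t x‖ ≤ 2 Y₀(R)` throughout. [cite: Kato1984, Thm. 2–4] -/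
theorem exists_sterile_levelZeroDataAt_tame_freeRun (R : TowerRates) :
    ∃ U : EuclideanSpace ℝ (Fin 3) → EuclideanSpace ℝ (Fin 3), LevelZeroDataAt R U 7 ∧ IsAxisymmetric U ∧ HasNoSwirl U ∧
      ∃ (v : ℝ → EuclideanSpace ℝ (Fin 3) → EuclideanSpace ℝ (Fin 3))
        (q : ℝ → EuclideanSpace ℝ (Fin 3) → ℝ),
        IsClassicalNSSolutionOn (Icc 1 (Host.τfirstAt R)) 1 0 v q ∧ v 1 = U ∧
        (∃ C : ℝ≥0∞, C < ⊤ ∧ ∀ t ∈ Icc (1 : ℝ) (Host.τfirstAt R), ∫⁻ x, ‖v t x‖ₑ ^ 2 ≤ C) ∧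
        ∀ t ∈ Icc (1 : ℝ) (Host.τfirstAt R), ∀ x, ‖v t x‖ ≤ 2 * R.Y 0 := by
  obtain ⟨c, hc, hrun⟩ := exists_classical_run_norm_le_two_mul_Icc
  obtain ⟨U, hLZ, hax, hsw, hsm, hcs, hdiv, hceil, hL3⟩ :=
    exists_sterile_levelZeroDataAt_small R (c * 1) (by rwa [mul_one])
  obtain ⟨v, q, hv, hv1, hE, hbd⟩ :=
    hrun one_pos (Host.one_lt_τfirstAt R) hsm hcs hdiv (R.Y_pos 0) hceil hL3
  exact ⟨U, hLZ, hax, hsw, v, q, hv, hv1, hE, hbd⟩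

/-- **THE STERILE TAME CARRIER RUN AT `R` UNDER THE DOOR'S CAP.** Under the registered band `2Y₀ ≤ Y₁`, for every margin
`η ≤ Y₁(R)/3` there is a STERILE strict-slot carrier at `R` with a classical finite-energy free run on `[1, τ₁(R)]` staying
below `(5/3) Y₁(R) − η`. [cite: Kato1984, Thm. 2–4] [cite: Palasek2026ElementaryModel, §3.3] -/
theorem exists_sterile_levelZeroDataAt_tame_freeRun_cap (hsep : 2 * R.Y 0 ≤ R.Y 1) {η : ℝ} (hη : η ≤ R.Y 1 / 3) :
    ∃ U : EuclideanSpace ℝ (Fin 3) → EuclideanSpace ℝ (Fin 3), LevelZeroDataAt R U 7 ∧ IsAxisymmetric U ∧ HasNoSwirl U ∧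
      ∃ (v : ℝ → EuclideanSpace ℝ (Fin 3) → EuclideanSpace ℝ (Fin 3))
        (q : ℝ → EuclideanSpace ℝ (Fin 3) → ℝ),
        IsClassicalNSSolutionOn (Icc 1 (Host.τfirstAt R)) 1 0 v q ∧ v 1 = U ∧
        (∃ C : ℝ≥0∞, C < ⊤ ∧ ∀ t ∈ Icc (1 : ℝ) (Host.τfirstAt R), ∫⁻ x, ‖v t x‖ₑ ^ 2 ≤ C) ∧
        ∀ t ∈ Icc (1 : ℝ) (Host.τfirstAt R), ∀ x, ‖v t x‖ ≤ 5 / 3 * R.Y 1 - η := by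
  obtain ⟨U, hLZ, hax, hsw, v, q, hv, hv1, hE, hbd⟩ := exists_sterile_levelZeroDataAt_tame_freeRun R
  have hY := R.Y_pos 0
  have hcap : 2 * R.Y 0 ≤ 5 / 3 * R.Y 1 - η := by linarith
  exact ⟨U, hLZ, hax, hsw, v, q, hv, hv1, hE, fun t ht x => (hbd t ht x).trans hcap⟩

/-- **At the tuned rates** (`tuned_sep`): the sterile tame carrier run under `(5/3) Y₁ − η`, every `η ≤ Y₁/3`.
[cite: Kato1984, Thm. 2–4] [cite: Palasek2026ElementaryModel, §3.3] -/
theorem tuned_exists_sterile_levelZeroDataAt_tame_freeRun_cap {η : ℝ} (hη : η ≤ TowerRates.tuned.Y 1 / 3) :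
    ∃ U : EuclideanSpace ℝ (Fin 3) → EuclideanSpace ℝ (Fin 3), LevelZeroDataAt TowerRates.tuned U 7 ∧
      IsAxisymmetric U ∧ HasNoSwirl U ∧
      ∃ (v : ℝ → EuclideanSpace ℝ (Fin 3) → EuclideanSpace ℝ (Fin 3))
        (q : ℝ → EuclideanSpace ℝ (Fin 3) → ℝ),
        IsClassicalNSSolutionOn (Icc 1 (Host.τfirstAt TowerRates.tuned)) 1 0 v q ∧ v 1 = U ∧
        (∃ C : ℝ≥0∞, C < ⊤ ∧ ∀ t ∈ Icc (1 : ℝ) (Host.τfirstAt TowerRates.tuned), ∫⁻ x, ‖v t x‖ₑ ^ 2 ≤ C) ∧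
        ∀ t ∈ Icc (1 : ℝ) (Host.τfirstAt TowerRates.tuned), ∀ x, ‖v t x‖ ≤ 5 / 3 * TowerRates.tuned.Y 1 - η :=
  exists_sterile_levelZeroDataAt_tame_freeRun_cap (by simpa using TowerRates.tuned_sep 0) hη

end Summit.NavierStokesRegularity.FluidComputer.PalasekTowerClayBridge.Germ

end
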